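import Summits.Ventures.PackingBounds.Energy.TenPointCkSixDefs
import HarnessLib

/-!
# `TenPointCkSix`: the value of the bound `10(9c - F(1,1,1) - A(1)) = 1205/8`

Framing: lottery ticket; floor = certified bounds/negative ranges. Venture `PackingBounds`, cell
`pub-packcert`, energy family E3PT (pub-packcert-energy gen 15; n = 4, d = 8 kernel route = KERNEL-D6 double data route, size-split, list-route SOS bridge).
-/

noncomputable section

namespace Summit.Ventures.PackingBounds.Energy.TenPointCkSix

set_option maxRecDepth 20000 in
set_option maxHeartbeats 400000000 in
/-- The value of the bound: `10(9c - F(1,1,1) - A(1)) = 1205/8` (the `(1+t)^6`-energy of the configuration 'two orthogonal regular pentagons (4,10)' over ordered pairs). -/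
theorem bound_eqW6 : (10 : ℝ) * ((10 - 1) * c0KW6 - FexpKW6 1 1 1 - aPolyKW6 1) = ((1205 : ℝ)/8) := by
  unfold c0KW6 FexpKW6 FexpK_c0W6 FexpK_c1W6 FexpK_c2W6 FexpK_c3W6 FexpK_c4W6 FexpK_c5W6 aPolyKW6; ring

end Summit.Ventures.PackingBounds.Energy.TenPointCkSix
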